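import Summits.Langlands.Langlands.Theorems.RamifiedCoefficientSeedAdjointLiftingGL3BirthDefs
import Summits.Langlands.Langlands.Theorems.RamifiedCoefficientSeedAdjointLiftingGL3BirthDefs2
import Summits.Langlands.Langlands.Theorems.RamifiedCoefficientSeedAdjointLiftingGL3StubEnormousAdTransfer
import Literature.NumberTheory.GaloisRepresentations.EnormousSubgroup
import Literature.NumberTheory.GaloisRepresentations.CalegariEvenFontaineMazurTwo
import Literature.NumberTheory.GaloisRepresentations.NormalSubgroupsGL2
import Literature.GroupTheory.SpecificGroups.PGL2SubfieldCharP
import HarnessLib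
import Literature.NumberTheory.GaloisRepresentations.SymmPowerEnormous

/-!
# Route `RamifiedCoefficientSeed`, crux `AdjointLiftingGL3` (stmt-Langlands-16779), line `birth`:
# stub `stub_enormousAd` — `ρ̄(Γ_{ℚ(ζ_p)})` is enormous (ACC+ §7.1)

Hypothesis (3) of ACC+ Thm. 6.1.1 for `ρ̄ = τ ≅ η̄ ⊗ ad⁰(τ₀)` (`IsTwistedAdZero τ τ₀ ηb`: a matrix
identity `τ(g) = P (η̄(g) · Ad(τ₀ g)) P⁻¹`), `p ≥ 11`, `τ₀` of finite image whose projective image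
on `Γ_{ℚ(ζ_p)}` lies between `PSL₂(𝔽)` and `PGL₂(𝔽)` up to conjugacy (`BigProjImageOnCyclotomic`,
the output of the Dickson stub): the image `τ(Γ_{ℚ(ζ_p)})` is enormous (`Subgroup.IsEnormous`, ACC+
Def. 6.2.28).  On paper this is ACC+ Lemma 7.1.5 (`lemen`) — "if `l > 2n+1` and `H` is a finite
subgroup of `GL₂(𝔽̄_l)` containing `SL₂(𝔽_l)` then `Symm^{n-1} H` is enormous" — for `n = 3`
together with the remark after Def. 6.2.28 ("this only depends on the image of `H` in `PGL_n(k)`")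
and `ad⁰ ≅ Sym² ⊗ det⁻¹`.

* VENDORED (named fact, `def … : Prop`, taken as the hypothesis of `enormousAd_of_facts`):
  `ACC_symmSq_enormous_of_specialLinearGroup_le` — Lemma 7.1.5 for `n = 3` over an algebraic
  closure `k` of `𝔽_l` (`IsAlgClosure (ZMod l) k`), `Symm²` being the tree's
  `Matrix.GeneralLinearGroup.symSq`.  Its printed proof quotes Dickson and Gee–Newton, *Patching
  and the completed homology of locally symmetric spaces* ([geenew]); not in reach.
* PROVED: (i) the remark after Def. 6.2.28 in the form needed (part II,
  `isEnormous_of_forall_exists_eq_scalar_mul_conj`: `H` and `g H' g⁻¹` with the same projective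
  image, units of `k` of order prime to `p`); (ii) `ℤ̄_p/𝔪` is an algebraic closure of `𝔽_p`
  with units of order prime to `p` (part I); (iii) here: the perfect group `SL₂(𝔽_p)` (`p ≥ 5`) lies
  in a conjugate `H₁ = s₀ τ₀(Γ_{ℚ(ζ_p)}) s₀⁻¹` as soon as its image lies in the projective image
  (`le_of_commutator_eq_self_of_map_mk_le` of `NormalSubgroupsGL2`, ACC+'s own argument in the proof
  of Lemma 7.1.4), the constant change of basis `Ad⁰(g) = (det g)⁻¹ · Q Sym²(g) Q⁻¹`,
  `Q = (0 1 0; -2 0 0; 0 0 2)` (`glAdZeroTwoFrame_eq_conj_symSq`, an explicit `3 × 3` identity), and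
  the bookkeeping `τ(γ) = c_γ · g₀ Sym²(s₀ τ₀(γ) s₀⁻¹) g₀⁻¹`, `g₀ = P Q Sym²(s₀)⁻¹`, feeding (i).

Main statement: `enormousAd_of_facts` = (vendored Lemma 7.1.5, `n = 3`) → registered signature of
`stub_enormousAd`.

References: [ACCGHLNSTT2023] §7.1 Lemma 7.1.5 (`lemen`; held arXiv:1812.09999 Lemma 134, p0098),
Def. 6.2.28 and the remark after it (held §6.2.9, Definition 90, p0071), proof of Lemma 7.1.4.
-/

set_option linter.dupNamespace false

noncomputable section

namespace Summit.Langlands.Langlands.Cruxes.AdjointLiftingGL3.Birth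

open scoped MatrixGroups Pointwise
open Field Matrix
open Literature.NumberTheory.GaloisRepresentations Literature.GroupTheory.SpecificGroups
open Literature.NumberTheory.EllipticCurves

/-! ## The vendored engine: ACC+ Lemma 7.1.5 (`lemen`) for `n = 3` -/

section Frame

variable {R : Type*} [CommRing R]

/-- **The intertwining identity** `Ad⁰(P) · Q = D · Q · Sym²(P)` for the adjugate frame
`P⁻¹ = D · adj(P)` and the constant matrix `Q = (0 1 0; -2 0 0; 0 0 2)` — twice the matrix of
`Sym² V ⊗ det⁻¹ ⥲ ad⁰`, `v · w ↦ (u ↦ ½([u,w] v + [u,v] w))` (`[u, v] = u₁ v₂ − u₂ v₁`), from the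
frame `e₁², e₁e₂, e₂²` of `Sym²` (`TernaryPairs.symSq`) to the frame `(diag(1,-1), E₁₂, E₂₁)` of
`ad⁰` (`glAdZeroTwoFrame`): `e₁² ↦ −E₁₂`, `e₁e₂ ↦ ½ diag(1,-1)`, `e₂² ↦ E₂₁`.  A polynomial identity
in the entries of `P` and `D`. [folklore] -/
theorem adZeroTwoMatrixOf_mul_changeOfBasis (P : Matrix (Fin 2) (Fin 2) R) (D : R) :
    adZeroTwoMatrixOf R P (D • !![P 1 1, -P 0 1; -P 1 0, P 0 0]) * !![0, 1, 0; -2, 0, 0; 0, 0, 2] =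
      D • (!![0, 1, 0; -2, 0, 0; 0, 0, 2] * TernaryPairs.symSq P) := by
  ext i j
  fin_cases i <;> fin_cases j <;>
    simp [adZeroTwoMatrixOf, TernaryPairs.symSq, Matrix.mul_apply, Fin.sum_univ_three] <;> ring

variable {k : Type*} [Field k]

/-- `Q = (0 1 0; -2 0 0; 0 0 2)` is invertible when `char k ≠ 2` (`det Q = 4`). [folklore] -/
theorem exists_changeOfBasisGL (h2 : (2 : k) ≠ 0) :
    ∃ Q : GL (Fin 3) k, (Q : Matrix (Fin 3) (Fin 3) k) = !![0, 1, 0; -2, 0, 0; 0, 0, 2] := by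
  have hdet : (!![0, 1, 0; -2, 0, 0; 0, 0, 2] : Matrix (Fin 3) (Fin 3) k).det = 2 * 2 := by
    simp [Matrix.det_fin_three]
  exact ⟨GeneralLinearGroup.mkOfDetNeZero _ (by rw [hdet]; exact mul_ne_zero h2 h2), rfl⟩

/-- The inverse in `GL₂(k)`: `g⁻¹ = (det g)⁻¹ · adj(g)`. [folklore] -/
theorem coe_inv_eq_smul_adjugate (g : GL (Fin 2) k) :
    ((g⁻¹ : GL (Fin 2) k) : Matrix (Fin 2) (Fin 2) k) =
      ((GeneralLinearGroup.det g : kˣ) : k)⁻¹ •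
        !![(g : Matrix (Fin 2) (Fin 2) k) 1 1, -(g : Matrix (Fin 2) (Fin 2) k) 0 1;
          -(g : Matrix (Fin 2) (Fin 2) k) 1 0, (g : Matrix (Fin 2) (Fin 2) k) 0 0] := by
  rw [Matrix.coe_units_inv]
  refine Matrix.inv_eq_left_inv ?_
  have hdet : ((GeneralLinearGroup.det g : kˣ) : k) =
      (g : Matrix (Fin 2) (Fin 2) k) 0 0 * (g : Matrix (Fin 2) (Fin 2) k) 1 1 -
        (g : Matrix (Fin 2) (Fin 2) k) 0 1 * (g : Matrix (Fin 2) (Fin 2) k) 1 0 := by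
    rw [GeneralLinearGroup.val_det_apply, Matrix.det_fin_two]
  have hne : (g : Matrix (Fin 2) (Fin 2) k) 0 0 * (g : Matrix (Fin 2) (Fin 2) k) 1 1 -
      (g : Matrix (Fin 2) (Fin 2) k) 0 1 * (g : Matrix (Fin 2) (Fin 2) k) 1 0 ≠ 0 :=
    hdet ▸ (GeneralLinearGroup.det g).ne_zero
  rw [hdet]
  ext i j
  fin_cases i <;> fin_cases j <;>
    simp [Matrix.mul_apply, Fin.sum_univ_two] <;> field_simp <;> ring

/-- **`Ad⁰ = det⁻¹ · Q Sym² Q⁻¹` in `GL₃(k)`** (`char k ≠ 2`): the tree's framed adjoint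
representation `glAdZeroTwoFrame` (`AdZeroBlochKatoDatum`) is the twist by `det⁻¹` of the
symmetric square `GeneralLinearGroup.symSq`, conjugated by the CONSTANT matrix
`Q = (0 1 0; -2 0 0; 0 0 2)`. [folklore] -/
theorem glAdZeroTwoFrame_eq_conj_symSq {Q : GL (Fin 3) k}
    (hQ : (Q : Matrix (Fin 3) (Fin 3) k) = !![0, 1, 0; -2, 0, 0; 0, 0, 2]) (g : GL (Fin 2) k) :
    glAdZeroTwoFrame k g =
      GeneralLinearGroup.scalar (Fin 3) (GeneralLinearGroup.det g)⁻¹ * Q *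
        GeneralLinearGroup.symSq g * Q⁻¹ := by
  rw [eq_mul_inv_iff_mul_eq]
  apply Units.ext
  rw [Units.val_mul, Units.val_mul, Units.val_mul, coe_glAdZeroTwoFrame_apply,
    coe_inv_eq_smul_adjugate, GeneralLinearGroup.coe_scalar, GeneralLinearGroup.coe_symSq,
    Matrix.scalar_apply, Matrix.mul_assoc, ← Matrix.smul_eq_diagonal_mul,
    Units.val_inv_eq_inv_val, hQ]
  exact adZeroTwoMatrixOf_mul_changeOfBasis _ _

end Frame

/-! ## The glue: `τ(Γ_{ℚ(ζ_p)})` is enormous -/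

/-- Group-theoretic bookkeeping with a central factor `z` (`z P = P z`):
`a P (z Q S Q⁻¹) P⁻¹ = a z (P Q T⁻¹) (T S T⁻¹) (P Q T⁻¹)⁻¹`. [folklore] -/
theorem conj_bookkeeping {G : Type*} [Group G] {a z P Q S T : G} (hz : z * P = P * z) :
    a * P * (z * Q * S * Q⁻¹) * P⁻¹ = a * z * (P * Q * T⁻¹) * (T * S * T⁻¹) * (P * Q * T⁻¹)⁻¹ := by
  calc a * P * (z * Q * S * Q⁻¹) * P⁻¹ = a * (P * z) * Q * S * Q⁻¹ * P⁻¹ := by group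
    _ = a * (z * P) * Q * S * Q⁻¹ * P⁻¹ := by rw [hz]
    _ = _ := by group

/-- **`SL₂(𝔽_p)` maps into `PSL₂(𝔽)`** for every subfield `𝔽` of a field `k` of characteristic `p`
(entries in the prime field, determinant `1`). [folklore] -/
theorem mk_mapGL_mem_pslTwo {k : Type*} [Field k] {p : ℕ} [Fact p.Prime] [Algebra (ZMod p) k]
    (𝔽 : Subfield k) (γ : SL(2, ZMod p)) :
    Matrix.ProjGenLinGroup.mk (Matrix.SpecialLinearGroup.mapGL k γ) ∈ PGL2.pslTwo 𝔽 := by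
  refine PGL2.mk_mem_pslTwo_of_forall_mem 𝔽 (fun i j => ?_) ?_
  · change algebraMap (ZMod p) k ((γ : Matrix (Fin 2) (Fin 2) (ZMod p)) i j) ∈ 𝔽
    rw [← ZMod.natCast_zmod_val ((γ : Matrix (Fin 2) (Fin 2) (ZMod p)) i j), map_natCast]
    exact natCast_mem 𝔽 _
  · change ((γ : Matrix (Fin 2) (Fin 2) (ZMod p)).map (algebraMap (ZMod p) k)).det = 1
    rw [← RingHom.mapMatrix_apply, ← RingHom.map_det, Matrix.SpecialLinearGroup.det_coe, map_one]

/-- **ACC+'s lifting step** (proof of Lemma 7.1.4, via `le_of_commutator_eq_self_of_map_mk_le`):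
if the image of `H ≤ GL₂(k)` in `PGL₂(k)` contains `PSL₂(𝔽)` for a subfield `𝔽`, `char k = p ≥ 5`,
then `H ⊇ SL₂(𝔽_p)` (the perfect group `SL₂(𝔽_p)` lies in `H · kˣ`, hence in `H`).
[cite: ACCGHLNSTT2023, §7.1, proof of Lemma 7.1.4] -/
theorem mapGL_range_le_of_pslTwo_le {k : Type*} [Field k] {p : ℕ} [Fact p.Prime]
    [Algebra (ZMod p) k] (hp : 5 ≤ p) (𝔽 : Subfield k) {H : Subgroup (GL (Fin 2) k)}
    (h : PGL2.pslTwo 𝔽 ≤ H.map Matrix.ProjGenLinGroup.mk) :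
    (Matrix.SpecialLinearGroup.mapGL k : SL(2, ZMod p) →* GL (Fin 2) k).range ≤ H := by
  refine le_of_commutator_eq_self_of_map_mk_le (commutator_mapGL_range_eq_self
    (exists_ne_zero_and_sq_ne_one_of_card (by rw [Nat.card_zmod]; omega))) ?_
  rintro _ ⟨_, ⟨γ, rfl⟩, rfl⟩
  exact h (mk_mapGL_mem_pslTwo 𝔽 γ)

/-- **Stub `stub_enormousAd` from the vendored Lemma 7.1.5** (ACC+ §7.1; hypothesis (3) of
Thm. 6.1.1 for the line): for `p ≥ 11`, `τ₀ : Γ_ℚ → GL₂(ℤ̄_p/𝔪)` of finite image with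
`BigProjImageOnCyclotomic p τ₀`, and `τ = P (η̄ · Ad τ₀) P⁻¹` (`IsTwistedAdZero τ τ₀ ηb`), the
image `τ(Γ_{ℚ(ζ_p)})` is enormous.  Proof: `H₁ = s₀ τ₀(Γ_{ℚ(ζ_p)}) s₀⁻¹ ⊇ SL₂(𝔽_p)` is finite, so
`Sym² H₁` is enormous by Lemma 7.1.5 (`k = ℤ̄_p/𝔪` is an algebraic closure of `𝔽_p`, part I);
`τ(γ) = c_γ · g₀ Sym²(s₀ τ₀ γ s₀⁻¹) g₀⁻¹` with `g₀ = P Q Sym²(s₀)⁻¹`, `c_γ = η̄(γ) det τ₀(γ)⁻¹`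
(`glAdZeroTwoFrame_eq_conj_symSq`), so `τ(Γ_{ℚ(ζ_p)})` and `g₀ (Sym² H₁) g₀⁻¹` have the same
projective image and part II applies. [cite: ACCGHLNSTT2023, §7.1, Lemma 7.1.5 and Def. 6.2.28] -/
theorem enormousAd_of_facts :
    Literature.NumberTheory.GaloisRepresentations.ACC_symmSq_enormous_of_specialLinearGroup_le →
    ∀ (p : ℕ) [Fact p.Prime], 11 ≤ p →
      ∀ τ₀ : absoluteGaloisGroup ℚ →* GL (Fin 2) (padicAlgClResidueField p),
        (Set.range τ₀).Finite →
        ∀ (τ : absoluteGaloisGroup ℚ →* GL (Fin 3) (padicAlgClResidueField p))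
          (ηb : absoluteGaloisGroup ℚ →* GL (Fin 1) (padicAlgClResidueField p)),
          IsTwistedAdZero τ τ₀ ηb → BigProjImageOnCyclotomic p τ₀ →
            Subgroup.IsEnormous ((absGaloisGroupAdjoinRootsOfUnity ℚ p).map τ) := by
  intro hLemen p _ hp τ₀ hfin τ ηb hτ hbig
  classical
  haveI := charP_padicAlgClResidueField p
  letI : Algebra (ZMod p) (padicAlgClResidueField p) := ZMod.algebra _ p
  haveI := isAlgClosure_zmod_padicAlgClResidueField p
  -- (a) a conjugate `H₁` of `τ₀(Γ_{ℚ(ζ_p)})` containing `SL₂(𝔽_p)`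
  obtain ⟨𝔽, t, -, hpsl, -⟩ := hbig
  obtain ⟨s₀, rfl⟩ := Matrix.ProjGenLinGroup.mk_surjective t
  set G' : Subgroup (absoluteGaloisGroup ℚ) := absGaloisGroupAdjoinRootsOfUnity ℚ p with hG'
  set H₁ : Subgroup (GL (Fin 2) (padicAlgClResidueField p)) :=
    (G'.map τ₀).map (MulAut.conj s₀).toMonoidHom with hH₁
  have hH₁fin : Finite H₁ := by
    have h0 : ((G'.map τ₀ : Subgroup _) : Set (GL (Fin 2) (padicAlgClResidueField p))).Finite := by
      rw [Subgroup.coe_map]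
      exact hfin.subset (Set.image_subset_range _ _)
    have h1 : (H₁ : Set (GL (Fin 2) (padicAlgClResidueField p))).Finite := by
      rw [hH₁, Subgroup.coe_map]
      exact h0.image _
    exact h1.to_subtype
  have hproj : PGL2.pslTwo 𝔽 ≤ H₁.map Matrix.ProjGenLinGroup.mk := by
    intro y hy
    have hy' := hpsl hy
    rw [Subgroup.mem_pointwise_smul_iff_inv_smul_mem, MulAut.smul_def, MulAut.conj_inv_apply] at hy'
    obtain ⟨γ', hγ'⟩ := hy'
    refine ⟨s₀ * τ₀ γ' * s₀⁻¹, ⟨τ₀ γ', ⟨γ', γ'.2, rfl⟩, rfl⟩, ?_⟩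
    change Matrix.ProjGenLinGroup.mk (τ₀ γ') = _ at hγ'
    rw [map_mul, map_mul, map_inv, hγ']
    group
  have hSL : (Matrix.SpecialLinearGroup.mapGL (padicAlgClResidueField p) :
      SL(2, ZMod p) →* GL (Fin 2) (padicAlgClResidueField p)).range ≤ H₁ :=
    mapGL_range_le_of_pslTwo_le (by omega) 𝔽 hproj
  -- (b) the engine: `Sym² H₁` is enormous
  have hEn : Subgroup.IsEnormous (H₁.map Matrix.GeneralLinearGroup.symSq) :=
    hLemen p (padicAlgClResidueField p) H₁ (by omega) hH₁fin hSL
  -- (c) `τ(γ) = c_γ · g₀ Sym²(s₀ τ₀ γ s₀⁻¹) g₀⁻¹`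
  obtain ⟨P, hP⟩ := hτ
  have h2 : (2 : padicAlgClResidueField p) ≠ 0 := by
    intro h
    have hdvd : p ∣ 2 := by
      rw [← CharP.cast_eq_zero_iff (padicAlgClResidueField p) p 2]
      exact_mod_cast h
    have := Nat.le_of_dvd two_pos hdvd
    omega
  obtain ⟨Q, hQ⟩ := exists_changeOfBasisGL h2
  set g₀ : GL (Fin 3) (padicAlgClResidueField p) :=
    P * Q * (Matrix.GeneralLinearGroup.symSq s₀)⁻¹ with hg₀
  have key : ∀ γ : absoluteGaloisGroup ℚ,
      τ γ = GeneralLinearGroup.scalar (Fin 3)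
          (GeneralLinearGroup.det (ηb γ) * (GeneralLinearGroup.det (τ₀ γ))⁻¹) * g₀ *
        Matrix.GeneralLinearGroup.symSq (s₀ * τ₀ γ * s₀⁻¹) * g₀⁻¹ := by
    intro γ
    have h1 : τ γ = GeneralLinearGroup.scalar (Fin 3) (GeneralLinearGroup.det (ηb γ)) * P *
        glAdZeroTwoFrame (padicAlgClResidueField p) (τ₀ γ) * P⁻¹ := by
      apply Units.ext
      rw [hP γ, Units.val_mul, Units.val_mul, Units.val_mul, GeneralLinearGroup.coe_scalar,
        GeneralLinearGroup.val_det_apply, Matrix.det_fin_one, Matrix.scalar_apply,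
        ← Matrix.smul_eq_diagonal_mul]
      simp only [Matrix.smul_mul, Matrix.mul_smul]
      rfl
    rw [h1, glAdZeroTwoFrame_eq_conj_symSq hQ (τ₀ γ), hg₀]
    simp only [map_mul, map_inv]
    have hz : (GeneralLinearGroup.scalar (Fin 3) (GeneralLinearGroup.det (τ₀ γ)))⁻¹ * P =
        P * (GeneralLinearGroup.scalar (Fin 3) (GeneralLinearGroup.det (τ₀ γ)))⁻¹ := by
      rw [← map_inv]
      exact GeneralLinearGroup.scalar_commute _ _
    exact conj_bookkeeping hz
  -- (d) same projective image as `g₀ (Sym² H₁) g₀⁻¹`: transfer (part II)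
  have h₁ : ∀ x ∈ G'.map τ, ∃ h' ∈ H₁.map Matrix.GeneralLinearGroup.symSq,
      ∃ c : (padicAlgClResidueField p)ˣ,
        x = GeneralLinearGroup.scalar (Fin 3) c * g₀ * h' * g₀⁻¹ := by
    rintro _ ⟨γ, hγ, rfl⟩
    exact ⟨_, ⟨s₀ * τ₀ γ * s₀⁻¹, ⟨τ₀ γ, ⟨γ, hγ, rfl⟩, rfl⟩, rfl⟩, _, key γ⟩
  have h₂ : ∀ h' ∈ H₁.map Matrix.GeneralLinearGroup.symSq, ∃ x ∈ G'.map τ,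
      ∃ c : (padicAlgClResidueField p)ˣ,
        x = GeneralLinearGroup.scalar (Fin 3) c * g₀ * h' * g₀⁻¹ := by
    rintro _ ⟨_, ⟨_, ⟨γ, hγ, rfl⟩, rfl⟩, rfl⟩
    exact ⟨τ γ, ⟨γ, hγ, rfl⟩, _, key γ⟩
  exact isEnormous_of_forall_exists_eq_scalar_mul_conj (exists_pow_eq_one_padicAlgClResidueField p)
    g₀ h₁ h₂ hEn

end Summit.Langlands.Langlands.Cruxes.AdjointLiftingGL3.Birth

end
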